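import Mathlib
import HarnessLib

/-!
# Eigen-decomposition of a rank-two Frobenius recurrence `φ²Λ − a·φΛ + q·Λ = 0`

Topic `Literature/NumberTheory/PAdicHodge`; THEOREMS ONLY (no definition, no named fact, no instance, no `sorry`). Pure module algebra: if
`α + β = a`, `αβ = q` (the roots of `X² − aX + q`) and an `S`-linear `φ` satisfies the Honda / Dieudonné relation `φ(φΛ) − a·φΛ + q·Λ = 0`, then
`Λ_α := φΛ − β·Λ` and `Λ_β := φΛ − α·Λ` are EIGENVECTORS: `φΛ_α = α·Λ_α`, `φΛ_β = β·Λ_β`, and `Λ_α − Λ_β = (α − β)·Λ`. Step 1 of the «eigen-frame»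
road for Kato's reciprocity law on the (G)-ORDINARY K★ cells (crux `stmt-BirchSwinnertonDyer-22226`, memo
`Cruxes/StarredOptimalManinUnitFiveSeven/Lines/kato-lever-seam-rec-at-cells.md` §6): with the unit root `α ∈ ℤ_p` of `FrobeniusUnitRoot`, the
`A_max`-periods `(Λ, φΛ)` of the φ-road recombine into the unit-root / non-unit-root eigen-periods `(Λ_α, Λ_β)` over `ℤ_p`.

* ★ `eigen_of_quadratic_recurrence` — the two eigen-relations; `sub_eigen_eq_smul` — `Λ_α − Λ_β = (α − β)·Λ`.

## References
* N. M. Katz, *Crystalline cohomology, Dieudonné modules, and Jacobi sums* (1981), §5 (unit-root splitting). [Katz1981CrystallineDieudonne]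
* T. Honda, J. Math. Soc. Japan 22 (1970), §2 (formal groups and their types). [Honda1970]
-/

namespace Literature.NumberTheory.PAdicHodge

variable {S M : Type*} [CommRing S] [AddCommGroup M] [Module S M]

/-- ★ **Eigenvectors of the recurrence `φ²Λ − a·φΛ + q·Λ = 0`**: for `α + β = a`, `αβ = q` and `S`-linear `φ`,
`φ(φΛ − β·Λ) = α·(φΛ − β·Λ)` and `φ(φΛ − α·Λ) = β·(φΛ − α·Λ)`. [cite: Katz1981CrystallineDieudonne, §5] -/
theorem eigen_of_quadratic_recurrence (φ : M →ₗ[S] M) {a q α β : S} (hsum : α + β = a) (hprod : α * β = q)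
    {Λ : M} (hΛ : φ (φ Λ) - a • φ Λ + q • Λ = 0) :
    φ (φ Λ - β • Λ) = α • (φ Λ - β • Λ) ∧ φ (φ Λ - α • Λ) = β • (φ Λ - α • Λ) := by
  have h1 : φ (φ Λ) = a • φ Λ - q • Λ := by
    rw [← sub_eq_zero]
    rw [← hΛ]
    abel
  subst hsum hprod
  constructor
  · rw [map_sub, map_smul, h1]
    module
  · rw [map_sub, map_smul, h1]
    module

omit [Module S M] in
/-- `Λ_α − Λ_β = (α − β)·Λ` for `Λ_α = φΛ − β·Λ`, `Λ_β = φΛ − α·Λ` (so `Λ` is recovered from the eigen-pair when `α − β` is invertible).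
[cite: Katz1981CrystallineDieudonne, §5] -/
theorem sub_eigen_eq_smul [Module S M] (x : M) (α β : S) (Λ : M) :
    (x - β • Λ) - (x - α • Λ) = (α - β) • Λ := by
  module

end Literature.NumberTheory.PAdicHodge
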